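import Literature.AnabelianGeometry.EtaleTheta.FrobenioidMonoThetaSchemaNegative
import Literature.AnabelianGeometry.EtaleTheta.Discharge.Sec5Lemma58ActsByCyclotome

/-!
# [EtTh] §5, Lemma 5.8 / 5.9 (iv): a closed KUMMER TOY §5/§2 datum — units WITH a Galois action, constants, a non-trivial cyclotomic character (pp. 331–332 / PDF pp. 105–106)

Mochizuki, *The étale theta function and its Frobenioid-theoretic manifestations*, Publ. RIMS **45**
(2009), Lemma 5.8 p.331 (PDF p.105), Lemma 5.9 (iv) p.332 (PDF p.106) [cite: MochizukiEtTh2009, Lem 5.8 p.331 (PDF p.105)].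
abc-iut cell, block F (fact-proving wave), seat abc-iut-f-120 (gen 2); FACT-LIST rows **F-0534**
(`ThetaFrobenioid.ActsByCyclotome`), **F-0535** (`ThetaFrobenioid.ConstantsActByCyclotome`), **F-0533**
(`ThetaFrobenioid.IdentifiesPiY`), **F-1307** (`ThetaFrobenioid.CyclotomicCharacterCompat`).  WITNESS DATA (definitions
+ computation lemmas) over this seat's constructor `Toy.frd` (`FrobenioidThetaToyData.lean`); nothing landed is edited,
no `Prop` fact, no instance, no notation.  The POSITIVE companion of `FrobenioidMonoThetaSchemaNegative.lean`: there the
universal closures of the four rows were refuted over toy data no. 1–3, each of which LACKS one ingredient of the genuine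
situation (units without Galois action, a trivial character, …); here is toy data no. 4 that HAS all of them, at which the
proof-only sibling `Discharge/Sec5Lemma58ToyKummerWitness.lean` shows the four rows holding JOINTLY with every binder live.

THE KUMMER TOY (a cartoon of "Kummer theory over `K`" in the proof of Lemma 5.8: `G_K` acting on `N`-th roots):
* "`G_K`" `:= ℤ^× = {±1}` (think `Gal(K(μ₃)/K)`), level `N := 3`, cyclotome `μ₃ := ℤ/3` (multiplicative);
* "`O^×(B_N^birat)`" `:= B₄ := (μ₃ × ℤ) × ℚ^×` with `G_K` acting by `invFstAction`: `−1` INVERTS the factor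
  `A₄ := μ₃ × ℤ` (the cyclotome and a unit of infinite order are Galois-MOVED) and FIXES the constants "`K^×`"
  `:= ℚ^× ↪ B₄` (last factor) — so that the Galois invariants of `B₄` are exactly the constants;
* "`Aut_C(B_N)`" `:= G₄ := B₄ ⋊ ℤ^×` over "`Aut_D(B_N^bs)`" `:= ℤ^×` (`π₄ = rightHom`): ALL birational units are units
  of `B_N` (`O^×(B_N) = Ker π₄ = inl(B₄)`), and conjugation by a lift of `ε ∈ ℤ^×` IS the Galois action (`conj_inl_G₄`);
* the §5 datum **`toy₄ := Toy.frd π₄ …`** with sections `s^trv_N = s^⊓-gp_N = s^⊔-gp_N := inr` and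
  `ρ₀ := par : Π = ℤ × ℤ × 𝔖₃ ↠ ℤ^×`, the parity of the second `ℤ`-coordinate — so `Π^tp_Y̲ = Ker(first coordinate)`
  and `Π^tp_Ÿ̲` both surject onto `G_K` (`imPiY_toy₄_eq_top`) and "`Π^tp_Y` [i.e., `G_K` …] acts" on the units
  by the Galois action (`homOf_conj_sgpCap_rho_toy₄`);
* the §2 datum **`env₄ : ThetaEnvData 3`** over the SAME `Π`, `Π^tp_Y := Ker(first coordinate)`, `G_K := ℤ^×` via `par`,
  cyclotome `μ₃` with the NON-TRIVIAL character `χ := invAction` (`env₄_chi_ne_one`), theta cocycles = all coboundaries;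
* the identification of cyclotomes **`muEquiv₄ : μ_3(B_N) ⥲ μ₃`** (`μ_3(B_N) = μ₃ × 1 × 1`, `ubμ_torsion`, `B₄_torsion`)
  and abc-iut-L2-t11's birational-action hypothesis structure INHABITED: **`act₄ : toy₄.BiratAutAction`**.
In this toy `μ_N(B_N) = μ₃ ⊊ (O_K^×)^{1/N} = μ₃ × 1 × ℚ^× ⊊ O^×(B_N) = B₄` (sibling file).
HONEST FRAMING: toy data exhibiting the JOINT CONSISTENCY of the typed §5/§2 interfaces and of the hypotheses under
which the tree discharges Lemma 5.8 / 5.9 (iv); they say nothing about the genuine curve data of [EtTh] (a refereed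
paper), nothing about [IUTchIII] Cor. 3.12, and take no side; typed ≠ proved.
-/

namespace Literature.AnabelianGeometry.EtaleTheta

open CategoryTheory
open Literature.AlgebraicGeometry.Frobenioids

namespace ThetaFrobenioid

namespace Toy

/-! ### The Kummer toy: a `ℤ^×`-module of "birational units" with constants `ℚ^×` -/

/-- `ℤ^× = {±1}` acting on a product `A × Q` of abelian groups by `u ↦ ((a, q) ↦ (a^u, q))`: inversion on
the first factor, trivially on the second ("`G_K` moves the roots, fixes the constants"). [folklore] -/
def invFstAction (A Q : Type) [CommGroup A] [CommGroup Q] : ℤˣ →* MulAut (A × Q) where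
  toFun u :=
    { toFun := fun x => (x.1 ^ (u : ℤ), x.2)
      invFun := fun x => (x.1 ^ (u : ℤ), x.2)
      left_inv := fun x => Prod.ext (by
        change (x.1 ^ (u : ℤ)) ^ (u : ℤ) = x.1
        rw [← zpow_mul, Int.units_coe_mul_self, zpow_one]) rfl
      right_inv := fun x => Prod.ext (by
        change (x.1 ^ (u : ℤ)) ^ (u : ℤ) = x.1
        rw [← zpow_mul, Int.units_coe_mul_self, zpow_one]) rfl
      map_mul' := fun x y => Prod.ext (mul_zpow x.1 y.1 _) rfl }
  map_one' := by
    ext x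
    · change x.1 ^ ((1 : ℤˣ) : ℤ) = x.1
      rw [Units.val_one, zpow_one]
    · rfl
  map_mul' u v := by
    ext x
    · change x.1 ^ ((u * v : ℤˣ) : ℤ) = (x.1 ^ (v : ℤ)) ^ (u : ℤ)
      rw [Units.val_mul, zpow_mul']
    · rfl

/-- `invFstAction` on elements (plumbing for computing the toy Galois action on `O^×(B_N^birat)`).
[cite: MochizukiEtTh2009, Lem 5.8 p.331 (PDF p.105)] -/
@[simp] theorem invFstAction_apply (A Q : Type) [CommGroup A] [CommGroup Q] (u : ℤˣ) (x : A × Q) :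
    invFstAction A Q u x = (x.1 ^ (u : ℤ), x.2) := rfl

/-- The Galois-moved part of the toy units: `A₄ := μ₃ × ℤ` (a cyclotome of order `3` and a unit of infinite
order, both inverted by `−1 ∈ ℤ^×`). [folklore] -/
abbrev A₄ : Type := Multiplicative (ZMod 3) × Multiplicative ℤ

/-- The toy birational units `O^×(B_N^birat) := A₄ × ℚ^×`, the second factor being the constants
`K^× = ℚ^×`. [folklore] -/
abbrev B₄ : Type := A₄ × ℚˣ

/-- The toy Galois action `ℤ^× → Aut(O^×(B_N^birat))`. [folklore] -/
abbrev φ₄ : ℤˣ →* MulAut B₄ := invFstAction A₄ ℚˣ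

/-- The toy automorphism group `Aut_C(B_N) := O^×(B_N^birat) ⋊ ℤ^×` (every birational unit is a unit of
`B_N`; `Aut_D(B_N^bs) = ℤ^×`). [folklore] -/
abbrev G₄ : Type := B₄ ⋊[φ₄] ℤˣ

/-- The toy base projection `Aut_C(B_N) ↠ Aut_D(B_N^bs) = ℤ^×`. [folklore] -/
abbrev π₄ : G₄ →* ℤˣ := SemidirectProduct.rightHom

/-- `Ker(G₄ ↠ ℤ^×) = O^×(B_N^birat)` is abelian. [folklore] -/
private theorem comm_of_π₄ (a b : G₄) (ha : π₄ a = 1) (hb : π₄ b = 1) : a * b = b * a := by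
  change a.right = 1 at ha
  change b.right = 1 at hb
  refine SemidirectProduct.ext ?_ ?_
  · rw [SemidirectProduct.mul_left, SemidirectProduct.mul_left, ha, hb, map_one, MulAut.one_apply,
      MulAut.one_apply, mul_comm]
  · rw [SemidirectProduct.mul_right, SemidirectProduct.mul_right, mul_comm]

/-- Conjugating a unit `inl b` by `g ∈ Aut_C(B_N)` is the Galois action of `g^bs`: `g·inl(b)·g⁻¹ = inl(g^bs · b)`
(plumbing for computing in `Aut_C(B_N)` of the toy).  [cite: MochizukiEtTh2009, Lem 5.8 p.331 (PDF p.105)] -/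
theorem conj_inl_G₄ (g : G₄) (b : B₄) :
    g * SemidirectProduct.inl b * g⁻¹ = SemidirectProduct.inl (φ₄ g.right b) := by
  refine SemidirectProduct.ext ?_ ?_
  · simp only [SemidirectProduct.mul_left, SemidirectProduct.mul_right, SemidirectProduct.inv_left,
      SemidirectProduct.left_inl, SemidirectProduct.right_inl, mul_one, ← MulAut.mul_apply, ← map_mul,
      mul_inv_cancel, map_one, MulAut.one_apply]
    rw [mul_comm g.left, mul_assoc, mul_inv_cancel, mul_one]
  · simp only [SemidirectProduct.mul_right, SemidirectProduct.inv_right, SemidirectProduct.right_inl,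
      mul_one, mul_inv_cancel]

/-- `O^×(S) → O^×(B_N^birat)`, `u ↦ u.left`: "the natural inclusion `O^×(B_N) ↪ O^×(B_N^birat)`" of the toy
(a homomorphism on the `Ker π₄`-automorphisms). [cite: MochizukiEtTh2009, Lem 5.8 p.331 (PDF p.105)] -/
def leftHom₄ (S : SingleObj G₄) : (pre π₄).unitsSubgroup S →* B₄ where
  toFun u := (homOf G₄ S u).left
  map_one' := rfl
  map_mul' a b := by
    have ha : (homOf G₄ S a).right = 1 := (mem_unitsSubgroup_pre_iff π₄ S _).mp a.2
    change (homOf G₄ S (a.1 * b.1)).left = (homOf G₄ S a).left * (homOf G₄ S b).left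
    rw [map_mul, SemidirectProduct.mul_left, ha, map_one, MulAut.one_apply]

/-- A unit of the toy is `inl` of its image in `O^×(B_N^birat)`. [folklore] -/
private theorem homOf_eq_inl_leftHom₄ (S : SingleObj G₄) (u : (pre π₄).unitsSubgroup S) :
    homOf G₄ S u = SemidirectProduct.inl (leftHom₄ S u) := by
  have hu : (homOf G₄ S u).right = 1 := (mem_unitsSubgroup_pre_iff π₄ S _).mp u.2
  rw [← SemidirectProduct.inl_left_mul_inr_right (homOf G₄ S u), hu, map_one, mul_one]
  rfl

/-- `u ↦ u.left` is injective on `O^×(S)`. [folklore] -/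
private theorem leftHom₄_injective (S : SingleObj G₄) : Function.Injective (leftHom₄ S) := by
  intro a b h
  have h' : homOf G₄ S a = homOf G₄ S b := by
    rw [homOf_eq_inl_leftHom₄, homOf_eq_inl_leftHom₄, h]
  exact Subtype.ext (homOf_injective G₄ S h')

/-- The toy "`Π^tp_X̲ ↠ G_K = ℤ^×`": the parity of the SECOND `ℤ`-coordinate of `Π = ℤ × ℤ × 𝔖₃` (so that
both `Π^tp_Y̲ = Ker(first coordinate)` and `Π^tp_Ÿ̲` surject onto `G_K`). [folklore] -/
def par : Pi →* ℤˣ := (zpowersHom ℤˣ (-1)).comp zq'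

/-- The element `y₄ := (0, 1, id) ∈ Π^tp_Ÿ̲ ⊆ Π^tp_Y̲` with `par y₄ = −1`. [folklore] -/
def y₄ : Pi := (1, (Multiplicative.ofAdd 1, 1))

/-- `par y₄ = −1`: `Π^tp_Y̲ ∋ y₄` maps ONTO `G_K` (plumbing for `Im(Π^tp_Y̲)`, Lemma 5.9 (ii)).
[cite: MochizukiEtTh2009, Lem 5.9 (ii) p.332 (PDF p.106)] -/
@[simp] theorem par_y₄ : par y₄ = -1 := by
  change ((-1 : ℤˣ)) ^ Multiplicative.toAdd (Multiplicative.ofAdd (1 : ℤ)) = -1; rfl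

/-- `y₄ ∈ Ker(Π ↠ ℤ) = Π^tp_Y̲` (plumbing for `Im(Π^tp_Y̲)`, Lemma 5.9 (ii)). [cite: MochizukiEtTh2009, Lem 5.9 (ii) p.332 (PDF p.106)] -/
theorem y₄_mem_ker : y₄ ∈ zq.ker := MonoidHom.mem_ker.mpr rfl

/-- `par : Π ↠ ℤ^×` is onto. [folklore] -/
private theorem par_surjective : Function.Surjective par := by
  intro u
  rcases Int.units_eq_one_or u with rfl | rfl
  · exact ⟨1, map_one par⟩
  · exact ⟨y₄, par_y₄⟩

/-! ### Toy §5 datum no. 4 (the Kummer toy) -/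

/-- **Toy §5 data no. 4 (Kummer toy)**: `C := B(O^×(B_N^birat) ⋊ ℤ^×)`, `D := Bℤ^×`, all units birational units
(`O^×(B_N) = O^×(B_N^birat) = μ₃ × ℤ × ℚ^×`), constants `ℚ^× ↪` the last factor, `N := 3`, sections
`s^trv_N = s^⊓-gp_N = s^⊔-gp_N := inr`, `ρ₀ := par` (so `Π^tp_Y̲` acts on the units through `G_K = ℤ^×` by
the Galois action `φ₄`).  [folklore] -/
abbrev toy₄ : ThetaFrobenioid.{0} (SingleObj G₄) (SingleObj ℤˣ) :=
  frd π₄ comm_of_π₄ B₄ leftHom₄ leftHom₄_injective SemidirectProduct.inr par par_surjective 3 ℚ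
    (MonoidHom.inr A₄ ℚˣ) (fun _ _ h => (Prod.ext_iff.mp h).2)

/-- `O^×(B_N)` of the Kummer toy: the automorphisms over `Ker(ℤ^×)`, i.e. with trivial `ℤ^×`-component.
[cite: MochizukiEtTh2009, §5 p.331 (PDF p.105)] -/
theorem mem_units_toy₄_iff (u : Aut toy₄.BN) : u ∈ toy₄.units toy₄.BN ↔ (homOf G₄ _ u).right = 1 :=
  mem_unitsSubgroup_pre_iff π₄ _ u

/-- `autEquiv ∘ homOf = id` on `Aut(⋆)` (plumbing for computing in `Aut_D(B_N^bs)` of the toy; the inverse direction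
`(autEquiv G).symm a = homOf G ⋆ a` is abc-iut-f-116's `Toy.autEquiv_symm_apply`, `Discharge/Sec5DictionaryJointWitness.lean`).
[cite: MochizukiEtTh2009, §5 p.331 (PDF p.105)] -/
theorem autEquiv_homOf (H : Type) [Group H] (z : Aut (SingleObj.star H)) : autEquiv H (homOf H _ z) = z :=
  Aut.ext rfl

/-- `s^⊓-gp_N(ρ x) = inr(par x)`. [cite: MochizukiEtTh2009, Lem 5.9 (iii) p.332 (PDF p.106)] -/
theorem homOf_sgpCap_rho_toy₄ (x : Pi) :
    homOf G₄ _ (toy₄.sgpCap (toy₄.ρ x)) = SemidirectProduct.inr (par x) :=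
  homOf_sgpCap_rho π₄ comm_of_π₄ B₄ leftHom₄ leftHom₄_injective SemidirectProduct.inr par par_surjective 3 ℚ
    _ _ x

/-- "The natural inclusion `O^×(B_N) ↪ O^×(B_N^birat)`" of the Kummer toy, valued in `B₄ = (μ₃ × ℤ) × ℚ^×`
(the §5 stub field `unitsToBirat`, with its codomain spelled out).  [cite: MochizukiEtTh2009, Lem 5.8 p.331 (PDF p.105)] -/
abbrev ub (u : toy₄.units toy₄.BN) : B₄ := toy₄.unitsToBirat toy₄.BN u

/-- A unit of the Kummer toy is `inl` of its image under "the natural inclusion `O^×(B_N) ↪ O^×(B_N^birat)`".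
[cite: MochizukiEtTh2009, Lem 5.8 p.331 (PDF p.105)] -/
theorem homOf_unit_toy₄ (u : toy₄.units toy₄.BN) :
    homOf G₄ _ (u : Aut toy₄.BN) = SemidirectProduct.inl (ub u) :=
  homOf_eq_inl_leftHom₄ _ u

/-- Conjugation of a unit by `s^⊓-gp_N(ρ x)` is the Galois action of the image `par x ∈ G_K = ℤ^×` on
`O^×(B_N^birat)`: "`Π^tp_Y` [i.e., `G_K`, via the natural surjection `Π^tp_Y ↠ G_K`] acts" (proof of Lemma 5.8).
[cite: MochizukiEtTh2009, Lem 5.8 proof p.331 (PDF p.105)] -/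
theorem homOf_conj_sgpCap_rho_toy₄ (x : Pi) (u : toy₄.units toy₄.BN) :
    homOf G₄ _ (toy₄.sgpCap (toy₄.ρ x) * (u : Aut toy₄.BN) * (toy₄.sgpCap (toy₄.ρ x))⁻¹) =
      SemidirectProduct.inl (φ₄ (par x) (ub u)) := by
  rw [map_mul, map_mul, map_inv, homOf_sgpCap_rho_toy₄, homOf_unit_toy₄, ← map_inv,
    ← SemidirectProduct.inl_aut]

/-- `ρ(y₄) ∈ Im(Π^tp_Y̲)` (and `s^⊓-gp_N(ρ y₄) = inr(−1)`). [cite: MochizukiEtTh2009, Lem 5.9 (ii) p.332 (PDF p.106)] -/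
theorem rho_y₄_mem_imPiY : toy₄.ρ y₄ ∈ toy₄.imPiY := ⟨y₄, y₄_mem_ker, rfl⟩

/-- `Im(Π^tp_Y̲) = Aut_D(B_N^bs)`: `Π^tp_Y̲ ↠ G_K` is onto (`ρ(y₄) = −1`). [cite: MochizukiEtTh2009, Lem 5.9 (ii) p.332 (PDF p.106)] -/
theorem imPiY_toy₄_eq_top : toy₄.imPiY = ⊤ := by
  apply top_unique
  intro z _
  rw [← autEquiv_homOf ℤˣ z]
  rcases Int.units_eq_one_or (homOf ℤˣ (SingleObj.star ℤˣ) z) with h | h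
  · rw [h, map_one]
    exact toy₄.imPiY.one_mem
  · rw [h]
    exact ⟨y₄, y₄_mem_ker, by change autEquiv ℤˣ (par y₄) = _; rw [par_y₄]⟩

/-- The `3`-torsion of `O^×(B_N^birat) = (μ₃ × ℤ) × ℚ^×` is `μ₃`: a `3`-torsion element has trivial `ℤ`- and
`ℚ^×`-components ("the cyclotomic portion … of order `N`", Def. 5.4 / [FrdII] Def. 2.1 (i), for the toy).
[cite: MochizukiEtTh2009, Def 5.4 p.327 (PDF p.101)] -/
theorem B₄_torsion (b : B₄) (h : b ^ (3 : ℕ) = 1) : b.1.2 = 1 ∧ b.2 = 1 := by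
  have hz : b.1.2 ^ (3 : ℕ) = 1 := by
    have := congrArg (fun x : B₄ => x.1.2) h; simpa using this
  have hq : b.2 ^ (3 : ℕ) = 1 := by
    have := congrArg (fun x : B₄ => x.2) h; simpa using this
  refine ⟨?_, ?_⟩
  · have hz' := congrArg Multiplicative.toAdd hz
    rw [toAdd_pow, toAdd_one, nsmul_eq_mul] at hz'
    exact toAdd_eq_zero.mp (by push_cast at hz'; omega)
  · have hq' : ((b.2 : ℚˣ) : ℚ) ^ 3 = (1 : ℚ) ^ 3 := by
      rw [← Units.val_pow_eq_pow_val, hq, Units.val_one, one_pow]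
    exact Units.ext (by
      rw [Units.val_one]; exact (Odd.strictMono_pow (⟨1, rfl⟩ : Odd 3)).injective hq')

/-! ### The toy §2 datum over the same `Π`, with NON-TRIVIAL cyclotomic character -/

/-- **Toy §2 data no. 4** (`ThetaEnvData 3`): `Π^tp_X := ℤ × ℤ × 𝔖₃` with `Π^tp_Y := Ker` of the FIRST
`ℤ`-coordinate (the SAME subgroup as the §5 side's `Π^tp_Y̲`), `Π^tp_Ÿ := Π^tp_Y ∩ s3⁻¹(𝔄₃)`, Galois group
`G_K := ℤ^×` reached through `par` (onto from `Π^tp_Ÿ`), cyclotome `μ₃` on which `G_K` acts by the NON-TRIVIAL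
character "inversion" (`invAction`), and as theta cocycles the full class of coboundaries.  [folklore] -/
noncomputable def env₄ : ThetaEnvData.{0} 3 where
  PiX := Pi
  topPiX := ⊥
  tgPiX := by
    letI : TopologicalSpace Pi := ⊥
    haveI : DiscreteTopology Pi := ⟨rfl⟩
    infer_instance
  G := ℤˣ
  aug := par
  aug_surjective := par_surjective
  PiY := zq.ker
  PiY_normal := inferInstance
  PiY_open := by
    letI : TopologicalSpace Pi := ⊥
    haveI : DiscreteTopology Pi := ⟨rfl⟩
    exact isOpen_discrete _
  galYX := QuotientGroup.quotientKerEquivOfSurjective zq fun z => ⟨(z, 1), rfl⟩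
  PiYdd := piYdd
  PiYdd_le := inf_le_right
  PiYdd_normal := inferInstance
  PiYdd_open := by
    letI : TopologicalSpace Pi := ⊥
    haveI : DiscreteTopology Pi := ⟨rfl⟩
    exact isOpen_discrete _
  index_PiYdd := toy₄.relindex_PiYdd
  mu := Multiplicative (ZMod 3)
  topMu := ⊥
  discMu := @DiscreteTopology.mk (Multiplicative (ZMod 3)) ⊥ rfl
  mu_cyclic := inferInstance
  card_mu := by simp [ZMod.card]
  chi := invAction (Multiplicative (ZMod 3))
  chi_ker_open := by
    letI : TopologicalSpace Pi := ⊥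
    haveI : DiscreteTopology Pi := ⟨rfl⟩
    exact isOpen_discrete _
  thetaCocycles :=
    Set.range (CycEnvelope.coboundary (par.comp piYdd.subtype) (invAction (Multiplicative (ZMod 3))))
  thetaCocycles_nonempty := ⟨_, 1, rfl⟩
  isCocycle := by
    rintro _ ⟨c, rfl⟩
    exact CycEnvelope.isEnvCocycle_coboundary _ _ c
  locallyConstant := by
    letI : TopologicalSpace Pi := ⊥
    haveI : DiscreteTopology Pi := ⟨rfl⟩
    intro η _
    exact IsLocallyConstant.of_discrete η
  mul_coboundary_mem := by
    rintro _ ⟨c, rfl⟩ c'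
    refine ⟨c * c', funext fun g => ?_⟩
    simp only [Pi.mul_apply, CycEnvelope.coboundary]
    rw [map_mul, mul_inv, mul_mul_mul_comm]

/-- The character of the toy §2 datum is NON-TRIVIAL: `−1 ∈ G_K` inverts the cyclotome `μ₃`.
[cite: MochizukiEtTh2009, Def 2.13 p.273 (PDF p.47)] -/
theorem env₄_chi_ne_one : env₄.chi ((-1 : ℤˣ) : env₄.G) ≠ 1 := by
  intro h
  have h1 := congrArg (fun f : MulAut (Multiplicative (ZMod 3)) => f (Multiplicative.ofAdd 1)) h
  change Multiplicative.ofAdd (1 : ZMod 3) ^ (((-1 : ℤˣ)) : ℤ) = Multiplicative.ofAdd 1 at h1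
  rw [Units.val_neg, Units.val_one, zpow_neg, zpow_one] at h1
  exact absurd h1 (by decide)

/-! ### The identification of cyclotomes `m : μ_N(B_N) ⥲ μ_N` and the birational action -/

/-- The image in `O^×(B_N^birat) = B₄` of an element of `μ_N(B_N)`. [cite: MochizukiEtTh2009, Lem 5.8 p.331 (PDF p.105)] -/
abbrev ubμ (v : toy₄.muTorsion toy₄.BN toy₄.N) : B₄ :=
  ub (Subgroup.inclusion (toy₄.muTorsion_le_units toy₄.BN toy₄.N) v)

/-- An element of `μ_3(B_N)` has trivial `ℤ`- and `ℚ^×`-components in `O^×(B_N^birat)`: `μ_3(B_N) = μ₃ × 1 × 1`.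
[cite: MochizukiEtTh2009, Def 5.4 p.327 (PDF p.101)] -/
theorem ubμ_torsion (v : toy₄.muTorsion toy₄.BN toy₄.N) : (ubμ v).1.2 = 1 ∧ (ubμ v).2 = 1 := by
  apply B₄_torsion
  have hv : (Subgroup.inclusion (toy₄.muTorsion_le_units toy₄.BN toy₄.N) v) ^ (3 : ℕ) = 1 :=
    Subtype.ext v.2.2
  have h := map_pow (toy₄.unitsToBirat toy₄.BN) (Subgroup.inclusion (toy₄.muTorsion_le_units toy₄.BN toy₄.N) v) 3
  rw [hv, map_one] at h
  exact h.symm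

/-- `autEquiv(inl b)` is a unit of `B_N`, for every birational unit `b`. [cite: MochizukiEtTh2009, §5 p.331 (PDF p.105)] -/
theorem autEquiv_inl_mem_units (b : B₄) : autEquiv G₄ (SemidirectProduct.inl b) ∈ toy₄.units toy₄.BN :=
  (mem_units_toy₄_iff _).mpr (by rw [homOf_autEquiv]; rfl)

/-- … with image `b` in `O^×(B_N^birat)`. [cite: MochizukiEtTh2009, §5 p.331 (PDF p.105)] -/
theorem ub_autEquiv_inl (b : B₄) : ub ⟨autEquiv G₄ (SemidirectProduct.inl b), autEquiv_inl_mem_units b⟩ = b := rfl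

/-- Powers of `autEquiv(inl b)` (plumbing for the cyclotome `μ_N(B_N)` of the toy).
[cite: MochizukiEtTh2009, Def 5.4 p.327 (PDF p.101)] -/
theorem autEquiv_inl_pow (b : B₄) (n : ℕ) :
    autEquiv G₄ (SemidirectProduct.inl b) ^ n = autEquiv G₄ (SemidirectProduct.inl (b ^ n)) := by
  rw [map_pow, map_pow]

/-- `ζ ↦ inl((ζ, 0), 1)`: the cyclotome `μ₃ ↪ Aut_C(B_N)` of the toy. [folklore] -/
abbrev zetaAut (n : Multiplicative (ZMod 3)) : Aut toy₄.BN :=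
  autEquiv G₄ (SemidirectProduct.inl (((n, (1 : Multiplicative ℤ)), (1 : ℚˣ)) : B₄))

/-- `zetaAut n ∈ μ_3(B_N)`. [cite: MochizukiEtTh2009, Def 5.4 p.327 (PDF p.101)] -/
theorem zetaAut_mem (n : Multiplicative (ZMod 3)) : zetaAut n ∈ toy₄.muTorsion toy₄.BN toy₄.N := by
  have hn3 : ∀ m : Multiplicative (ZMod 3), m ^ (3 : ℕ) = 1 := by decide
  refine ⟨autEquiv_inl_mem_units _, ?_⟩
  change autEquiv G₄ (SemidirectProduct.inl _) ^ (3 : ℕ) = 1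
  rw [autEquiv_inl_pow, Prod.pow_mk, Prod.pow_mk, hn3, one_pow, one_pow]
  change autEquiv G₄ (SemidirectProduct.inl (1 : B₄)) = 1
  rw [map_one, map_one]

/-- **`m : μ_N(B_N) ⥲ μ_N`**, the identification of the §5 cyclotome `μ_3(B_N) = μ₃ × 1 × 1` with the §2 cyclotome
`μ₃` (`u ↦` its `μ₃`-component).  [cite: MochizukiEtTh2009, Lem 5.9 (iv) p.332 (PDF p.106)] -/
noncomputable def muEquiv₄ : toy₄.muTorsion toy₄.BN toy₄.N ≃* Multiplicative (ZMod 3) :=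
  MulEquiv.ofBijective
    ((MonoidHom.fst _ _).comp ((MonoidHom.fst _ _).comp ((toy₄.unitsToBirat toy₄.BN).comp
      (Subgroup.inclusion (toy₄.muTorsion_le_units toy₄.BN toy₄.N)))))
    ⟨fun a b h => by
        change (ubμ a).1.1 = (ubμ b).1.1 at h
        have hab : ubμ a = ubμ b :=
          Prod.ext (Prod.ext h ((ubμ_torsion a).1.trans (ubμ_torsion b).1.symm))
            ((ubμ_torsion a).2.trans (ubμ_torsion b).2.symm)
        exact Subgroup.inclusion_injective _ (toy₄.unitsToBirat_injective toy₄.BN hab),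
      fun n => ⟨⟨zetaAut n, zetaAut_mem n⟩, rfl⟩⟩

/-- `m` on elements: the `μ₃`-component. [cite: MochizukiEtTh2009, Lem 5.9 (iv) p.332 (PDF p.106)] -/
theorem muEquiv₄_apply (v : toy₄.muTorsion toy₄.BN toy₄.N) : muEquiv₄ v = (ubμ v).1.1 := rfl

/-- **"The natural action" of `Aut_C(B_N)` on `O^×(B_N^birat)`** for the toy (abc-iut-L2-t11's hypothesis structure
`BiratAutAction`, Def. 4.1 (iii)): `g` acts through `g^bs ∈ ℤ^×` by the Galois action `φ₄`; units act trivially,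
the inclusion `O^×(B_N) ↪ O^×(B_N^birat)` is equivariant (`conj_inl_G₄`), constants are fixed.
[cite: MochizukiEtTh2009, Def 4.1 (iii) p.313 (PDF p.87)] -/
def act₄ : toy₄.BiratAutAction where
  act := φ₄.comp (π₄.comp (homOf G₄ (SingleObj.star G₄)))
  act_unitsToBirat e u := by
    apply SemidirectProduct.inl_injective (N := B₄) (G := ℤˣ) (φ := φ₄)
    change SemidirectProduct.inl (φ₄ (π₄ (homOf G₄ _ e)) (ub u)) =
      SemidirectProduct.inl (ub ⟨e * (u : Aut toy₄.BN) * e⁻¹, (toy₄.units_normal toy₄.BN).conj_mem _ u.2 e⟩)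
    rw [← homOf_unit_toy₄]
    change _ = homOf G₄ _ (e * (u : Aut toy₄.BN) * e⁻¹)
    rw [map_mul, map_mul, map_inv, homOf_unit_toy₄, conj_inl_G₄]
    rfl
  act_units u := by
    change φ₄ (π₄ (homOf G₄ _ (u : Aut toy₄.BN))) = 1
    rw [show π₄ (homOf G₄ _ (u : Aut toy₄.BN)) = 1 from (mem_units_toy₄_iff _).mp u.2, map_one]
  act_constEmb e k := by
    change φ₄ (π₄ (homOf G₄ _ e)) (((1 : A₄), k) : B₄) = ((1 : A₄), k)
    rw [invFstAction_apply, one_zpow]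

end Toy

end ThetaFrobenioid

end Literature.AnabelianGeometry.EtaleTheta
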